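import Summits.PneNP.PneNP.Theses.RamseyThreshold

/-!
# Line `sos-pincer` — registered skeleton for the deciding crux `RandomRamseyHypothesis` (stmt-PneNP-2050)

STRATEGIST DECOMPOSITION (BC2 redirect of the RESTATED deciding crux; route PneNP/RamseyThreshold).
`RandomRamseyHypothesis` (X: for `0 < δ < 1/15` no SOUND polynomial-time `K₄`-arrowing certifier accepts
`G(n, n^{δ-2/5})` with probability `≥ 1/2` eventually) is at least as strong as the summit (`closes`), so it is
redirected to TWO typed pieces, both route items, joined by a probabilistic PINCER:

* `stub_sosBlind`     = X₁ = `SosBlindAboveThreshold` (stmt-PneNP-2051, crux rank 2): for `0 < δ < 1/15` some `c > 0`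
  has `Pr[degree-⌊n^c⌋ SOS fails to refute the non-arrowing CNF of G(n, n^{δ-2/5})] → 1` — an UNCONDITIONAL
  proof-complexity lower bound (engine in tree: `Literature.Computability.MetaComplexity.sosFailsToRefute_of_vecExpands`;
  birth line `Lines/sos-pincer-x1-pinned-parity-lift.lean`).
* `stub_sosCaptures`  = X₂ = `SosCapturesCertifiers` (stmt-PneNP-17626, crux rank 3, NEW): for `0 < δ < 1/15`, EVERY
  `c > 0` and every sound poly-time `f`, `Pr[f accepts G ∧ degree-⌊n^c⌋ SOS fails to refute] → 0` — "polynomial-degree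
  SOS captures every sound polynomial-time certifier on this ensemble" (the BKS/KMOW/HKPRSS SOS-optimality hypothesis,
  transplanted; the wall in SOS language; birth line `Lines/sos-pincer-x2-quiet-planting.lean`).
* `RandomRamseyHypothesis_of` — the ASSEMBLY, kernel-checked below (no sorry; the same proof is attached to the glue
  item stmt-PneNP-17642 `RandomRamseyHypothesisOfSosPincer` for a prover to land under Theorems/): a sound poly-time
  `f` with `Pr[acc] ≥ 1/2` eventually would give `1/2 ≤ Pr[acc] ≤ Pr[acc ∧ SOS fails] + (1 - Pr[SOS fails]) → 0 + 0`.
  The seam is the event-level estimate (PMF complement, union bound, `ℝ≥0∞` limits), not a propositional cut: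
  neither piece mentions `Pr[acc]` alone, neither gives X or `PneNP` by `exact? | simpa | aesop` (probes 4/4 fail,
  converses fail too), X₁ is attackable unconditionally and X₂ isolates exactly what is `P ≠ NP`-hard.

Honest caveat recorded in STRATEGY-CENSUS.md: modulo X₁, X₂ is equivalent to the `→ 0` form X⁰ of X
(X⁰ → X₂ trivially; X₁ ∧ X₂ → X⁰); the decomposition's content is the isolation of the unconditional theorem X₁ and the
relocation of the wall onto the SOS-blind event, where transfer tools (pseudo-calibration / low-degree / planted
quietness) act.  The measure in X₂ is essential: its instance-wise strengthening ("every graph accepted by a sound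
poly-time f has a degree-n^c SOS refutation") is expected to be FALSE (coNP-hardness gadgets for arrowing + Tulsiani's
SOS-gap transfer + Gaussian elimination on the decoded XOR instance).
-/

set_option linter.dupNamespace false

namespace Summit.PneNP.PneNP.Cruxes.RandomRamseyHypothesis.SosPincer

open scoped Classical
open Filter
open Summit.PneNP.PneNP.Theses.RamseyThreshold

/-- STUB 1 = piece X₁ (route item stmt-PneNP-2051 `SosBlindAboveThreshold`, cited BY NAME): polynomial-degree SOS is
blind above the Rödl–Ruciński threshold.  Unconditional; line `sos-pincer-x1-pinned-parity-lift`. -/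
theorem stub_sosBlind : SosBlindAboveThreshold := by
  sorry

/-- STUB 2 = piece X₂ (route item stmt-PneNP-17626 `SosCapturesCertifiers`, cited BY NAME): polynomial-degree SOS captures
every sound polynomial-time arrowing certifier on the window ensemble.  The wall; line `sos-pincer-x2-quiet-planting`. -/
theorem stub_sosCaptures : SosCapturesCertifiers := by
  sorry

/-- Complements for a `PMF`: `Pr[Sᶜ] = 1 - Pr[S]` (in `ℝ≥0∞`). [folklore] -/
theorem pmf_toOuterMeasure_compl {α : Type*} (p : PMF α) (S : Set α) :
    p.toOuterMeasure Sᶜ = 1 - p.toOuterMeasure S := by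
  have h : p.toOuterMeasure S + p.toOuterMeasure Sᶜ = 1 := by
    rw [PMF.toOuterMeasure_apply, PMF.toOuterMeasure_apply, ← ENNReal.tsum_add, ← p.tsum_coe]
    exact tsum_congr fun x => Set.indicator_self_add_compl_apply S p x
  have hS : p.toOuterMeasure S ≠ ⊤ := ne_top_of_le_ne_top ENNReal.one_ne_top (h ▸ le_self_add)
  exact ENNReal.eq_sub_of_add_eq hS (by rwa [add_comm] at h)

/-- The pincer inequality `Pr[A] ≤ Pr[A ∩ B] + (1 - Pr[B])`. [folklore] -/
theorem pmf_pincer {α : Type*} (p : PMF α) (A B : Set α) :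
    p.toOuterMeasure A ≤ p.toOuterMeasure (A ∩ B) + (1 - p.toOuterMeasure B) := by
  rw [← pmf_toOuterMeasure_compl]
  calc p.toOuterMeasure A ≤ p.toOuterMeasure ((A ∩ B) ∪ Bᶜ) := by
        refine MeasureTheory.OuterMeasure.mono _ ?_
        intro x hx
        by_cases hB : x ∈ B
        · exact Or.inl ⟨hx, hB⟩
        · exact Or.inr hB
    _ ≤ p.toOuterMeasure (A ∩ B) + p.toOuterMeasure Bᶜ := MeasureTheory.measure_union_le _ _

/-- Filter bookkeeping of the pincer: `Pr[Bₙ] → 1`, `Pr[Aₙ ∩ Bₙ] → 0` and `Pr[Aₙ] ≤ Pr[Aₙ ∩ Bₙ] + (1 - Pr[Bₙ])`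
are incompatible with `Pr[Aₙ] ≥ 1/2` eventually. [folklore] -/
theorem pincer_contra {μA μAB μB : ℕ → ENNReal}
    (hB : Tendsto μB atTop (nhds 1)) (hAB : Tendsto μAB atTop (nhds 0))
    (hacc : ∀ᶠ n in atTop, (1 / 2 : ENNReal) ≤ μA n)
    (hle : ∀ n, μA n ≤ μAB n + (1 - μB n)) : False := by
  have hsub : Tendsto (fun n => 1 - μB n) atTop (nhds (1 - 1)) :=
    ENNReal.Tendsto.sub tendsto_const_nhds hB (Or.inl ENNReal.one_ne_top)
  rw [tsub_self] at hsub
  have hsum : Tendsto (fun n => μAB n + (1 - μB n)) atTop (nhds (0 + 0)) := hAB.add hsub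
  rw [add_zero] at hsum
  have hhalf : (0 : ENNReal) < 1 / 2 := ENNReal.half_pos one_ne_zero
  obtain ⟨n, h1, h2⟩ := (hacc.and (hsum.eventually (gt_mem_nhds hhalf))).exists
  exact absurd (lt_of_le_of_lt (h1.trans (hle n)) h2) (lt_irrefl _)

/-- ASSEMBLY (kernel-checked, no sorry): `SosBlindAboveThreshold → SosCapturesCertifiers → RandomRamseyHypothesis`
(= the route's glue item `RandomRamseyHypothesisOfSosPincer`, stmt-PneNP-17642).  Given a sound poly-time `f`
accepting with probability `≥ 1/2` eventually, X₁ gives `c > 0` with `Pr[SOS_{⌊n^c⌋} fails] → 1`, X₂ at that `c`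
gives `Pr[f acc ∧ SOS_{⌊n^c⌋} fails] → 0`, and `pmf_pincer` + `pincer_contra` close the contradiction. -/
theorem RandomRamseyHypothesis_of :
    SosBlindAboveThreshold → SosCapturesCertifiers → RandomRamseyHypothesis := by
  intro h₁ h₂ δ hδ hδ' hex
  obtain ⟨f, hf, hsound, hacc⟩ := hex
  obtain ⟨c, hc, hblind⟩ := h₁ δ hδ hδ'
  have hcap := h₂ δ hδ hδ' c hc f hf hsound
  exact pincer_contra hblind hcap hacc fun n => pmf_pincer _ _ _

/-- The crux from the two registered stubs. -/
theorem RandomRamseyHypothesis_closed : RandomRamseyHypothesis :=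
  RandomRamseyHypothesis_of stub_sosBlind stub_sosCaptures

end Summit.PneNP.PneNP.Cruxes.RandomRamseyHypothesis.SosPincer
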